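import Mathlib
import HarnessLib
import Summits.HubbardSuperconductivity.HubbardSuperconductivity.Theorems.KLProgrammeKLRegimeEngineV8DefsG14

/-!
# Route `KLProgramme` — ENGINE child gen 8 (stmt-HubbardSuperconductivity-20437 `KLRegimeEngineV17F2`), skeleton-v2 export class #5 «(S)-transfer», names-only LAYER
# «Export8» = Export7 ∘ {cap `klTS`-KEYED: `klCTcap8 := klCTcap7·(1 + klTS) = 2²⁰·(1 + klTS)`} — AMENDMENT 25 SHRUNK TO «(X).3-KLTS-CAP»
# (plan g23 (R257) shape (a); plan g24 (R269)(C) text-elect `G := klEngGeo14`; k3c2-p2 g21 «(A25)-FLAT-HOST-VS-CHILD1» KL STATUS 2026-08-28 21:02Z: NO flat cubic,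
# NO `transferBarRelIdx3`, family `PairTransferRelFamilyK5` and step `PairTransferStep7` UNCHANGED; cell gate-hubbard-kl, seat hubbard-kl-p1 g23 = class-#5 text / door
# owner (R54d); CANDIDATE text — no token role until the pen's «A24∪A25» motion)

WHY.  k3c1-p1 g16's located «(X).3-KLTS-NUMERIC» (KL STATUS 18:33Z): the class-#5 producer's ROOM closes against the prefactor `r` with a right side carrying the
two-shell frame-area constant `klTS` (`…V8DefsG11`, `Classical.choose`-opaque, no numeric cap), so `r ≤ klCTcap7 = 2²⁰` cannot be certified; the pen's TEXT move
(R257) keys the cap by `klTS`: `r ≤ klCTcap7·(1 + klTS)`.  k3c2-p2 g20's `…V8DefsG14` (p661848) supplies the engine package `klEngGeo14` hosting ANY `r ≤ 2²⁰(1+klTS)`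
with the shares of record (`transferBarRelIdx_le_slots_klEngGeo14_of_cap`, `relBar_le_bars_klEngGeo14_of_cap`), and `…PairTransferOutClassCapShares` (p664671) books
the cap's `1/L`/cubic residue U-SIDE under ONE smallness `2²⁶·klTS·Klam·|U| ≤ 1` («(X).3-KLTS-CAP-QSIDE→USIDE»).  This layer is the corresponding TEXT, names only:
* §1 **`klCTcap8 := klCTcap7·(1 + klTS)`** (`klCTcap8_eq : = 2²⁰·(1+klTS)`), and the cap's U-side booking as a CLOSED U-door entry **`klTSCapU P := 1/(2²⁶·klTS·max Klam 0 + 1)`**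
  with its discharge **`hTU_of_le_klTSCapU`** (`0 < U ≤ klTSCapU P ⇒ 2²⁶·klTS·(Klam·|U|) ≤ 1` = the `hTU` binder of `hout_hE_cap_of_U`);
* §2 **`IsTransferPkg8`** (cap `klCTcap8`; `IsTransferPkg7.toPkg8` — every rev-14 witness is a witness, the (X).3 conjunct gets WEAKER), deferred **`klTransferPkg8 / klCT8 / klCTu8`**
  keyed `(P R Q₀ G Gth)` over the UNCHANGED step `PairTransferStep7` (the cap is read by the package predicate only), `klCT8_nonneg`, **`klCT8_le_klCTcap8`**, `klCT8_le_cap`,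
  `klCTu8_pos`, `pairTransferStep7_klCT8_of_exists/_of`, `exists_isTransferPkg8_of_step7`; the BUNDLED u-slot **`klCTu8T … Q cc := klCTu8 … Q cc ⊓ klTSCapU P`** (ONE U-table
  name carrying the producer's threshold AND (u1): `klCTu8T_le_klCTu8`, `klCTu8T_le_klTSCapU`, `klCTu8T_pos`, `hTU_of_le_klCTu8T`);
* §3 the unroll **`pairTransferRelFamilyK5_klCT8_all_of_exists`** (§C's `htr` line; argument list = the `klCT7` one verbatim) and `…_of_exists_T` (u-row at `klCTu8T`);
* §4 the (c) closer's (E2-F2) input BY NAME: **`pairLadderStepAtV17F2_of_relFamilyK5_klCT8`** (direct door at `r := klCT8`); the G14 hosting instances and the cap-generic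
  numerals (`transferBarRelIdx_klCT8_le_slots_klEngGeo14`, `relBar_klCT8_le_bars_klEngGeo14`, `thermal_content_le_of_cap`, `…_le_succ_shapes_of_cap`, …) are the sibling
  proof-only file `…V8PairTransferExport8Shares`.
RENDER DELTA (rev 15 «A24∪A25» candidate, registrant p1b's apply_a25.py): (X).3 `∃ e, IsTransferPkg8 e ∧ PairTransferStep7 P R (klEngQ7 P R) klEngGeo14 klEngGeoTh e.1 e.2`;
(c)/§C `PairTransferRelFamilyK5 L M klEngGeoTh P (klCT8 P R (klEngQ7 P R) klEngGeo14 klEngGeoTh) β U μ j`; §C `pairTransferRelFamilyK5_klCT8_all_of_exists h5 …` (or `_T`);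
token #14 `⊓ klCTu8T …` (u-row `_le_klCTu8T`) or `⊓ klCTu8 … ⊓ klTSCapU P`.  Definitions with bodies + order lemmas + real arithmetic over landed lemmas; nothing about the
model is asserted; nothing asserts (X).3, (c), K3 or superconductivity.  0 kit · 0 lit.
-/

noncomputable section

namespace Summit.HubbardSuperconductivity.HubbardSuperconductivity.Theorems.EngineV8

set_option linter.dupNamespace false -- summit = problem name (single-conjunct summit), D-0017

open Real Finset Literature.MathematicalPhysics.QuantumLattice Literature.Probability.LatticeModels
open Literature.MathematicalPhysics.QuantumLattice.FermiRG
open Summit.HubbardSuperconductivity.HubbardSuperconductivity.Theorems.KLProgrammeLegKernels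
open Summit.HubbardSuperconductivity.HubbardSuperconductivity.Theorems.DispersionFlow
open Summit.HubbardSuperconductivity.HubbardSuperconductivity.Theorems.KLRegimeSplit

/-! ## §1 The `klTS`-keyed cap and its U-side booking -/

/-- **`klCTcap8 := klCTcap7·(1 + klTS)`** — the `klTS`-KEYED cap on the class-#5 relative prefactor (AMENDMENT 25 «(X).3-KLTS-CAP», (R257) shape (a)). -/
def klCTcap8 : ℝ := klCTcap7 * (1 + klTS)

/-- `klCTcap8 = 2²⁰·(1 + klTS)` (the literal `…V8DefsG14`'s hosting lemmas read). -/
theorem klCTcap8_eq : klCTcap8 = 2 ^ 20 * (1 + klTS) := by unfold klCTcap8; rw [klCTcap7_eq]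

/-- `0 < klCTcap8`. -/
theorem klCTcap8_pos : 0 < klCTcap8 := by rw [klCTcap8_eq]; have := klTS_nonneg; positivity

/-- The Export7 cap is below the `klTS`-keyed one (`0 ≤ klTS`). -/
theorem klCTcap7_le_klCTcap8 : klCTcap7 ≤ klCTcap8 := by
  rw [klCTcap8_eq, klCTcap7_eq]; have := klTS_nonneg; nlinarith

/-- **`klTSCapU P := 1/(2²⁶·klTS·max P.Klam 0 + 1)`** — the cap's U-SIDE BOOKING as a closed U-door entry: below it `2²⁶·klTS·Klam·|U| ≤ 1`, the ONE smallness under which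
`…PairTransferOutClassCapShares` (`relBar_cap_residue_le_half_eremBar_of_U`, `hout_hE_cap_of_U`) books the capped bar's `1/L` and cubic residue into `½·eremBar` at the
`Q`-floor of record.  (`max … 0` only makes positivity unconditional.) -/
def klTSCapU (P : SplitConsts) : ℝ := 1 / (2 ^ 26 * klTS * max P.Klam 0 + 1)

/-- `0 < klTSCapU P` (unconditionally). -/
theorem klTSCapU_pos (P : SplitConsts) : 0 < klTSCapU P := by
  unfold klTSCapU
  have := klTS_nonneg
  have : 0 ≤ max P.Klam 0 := le_max_right _ _
  positivity

/-- `klTSCapU P ≤ 1`. -/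
theorem klTSCapU_le_one (P : SplitConsts) : klTSCapU P ≤ 1 := by
  unfold klTSCapU
  have := klTS_nonneg
  have : 0 ≤ max P.Klam 0 := le_max_right _ _
  rw [div_le_one (by positivity)]
  nlinarith

/-- **THE DISCHARGE of the cap's U-side smallness**: `0 < U ≤ klTSCapU P ⇒ 2²⁶·klTS·(P.Klam·|U|) ≤ 1` (the `hTU` binder of `hout_hE_cap_of_U` /
`relBar_cap_residue_le_half_eremBar_klEngGeo14_of_U`; no sign hypothesis on `P.Klam`). -/
theorem hTU_of_le_klTSCapU {P : SplitConsts} {U : ℝ} (hU : 0 < U) (hUle : U ≤ klTSCapU P) : 2 ^ 26 * klTS * (P.Klam * |U|) ≤ 1 := by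
  have hT := klTS_nonneg
  have hK : P.Klam ≤ max P.Klam 0 := le_max_left _ _
  have hK0 : 0 ≤ max P.Klam 0 := le_max_right _ _
  have hden : 0 < 2 ^ 26 * klTS * max P.Klam 0 + 1 := by positivity
  rw [abs_of_pos hU]
  have h1 : U * (2 ^ 26 * klTS * max P.Klam 0 + 1) ≤ 1 := by
    have h := mul_le_mul_of_nonneg_right hUle hden.le
    have e : klTSCapU P * (2 ^ 26 * klTS * max P.Klam 0 + 1) = 1 := by
      unfold klTSCapU; rw [one_div, inv_mul_cancel₀ hden.ne']
    rwa [e] at h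
  have h2 : 2 ^ 26 * klTS * (P.Klam * U) ≤ 2 ^ 26 * klTS * (max P.Klam 0 * U) :=
    mul_le_mul_of_nonneg_left (mul_le_mul_of_nonneg_right hK hU.le) (by positivity)
  nlinarith

/-! ## §2 The capped admissibility predicate and the deferred package (step `PairTransferStep7` UNCHANGED) -/

/-- **An admissible class-#5 package WITH THE `klTS`-KEYED CAP**: `0 ≤ r ≤ klCTcap8` and a coupling threshold positive at every raised package. -/
def IsTransferPkg8 (e : ℝ × (EngConsts → ℝ → ℝ)) : Prop := 0 ≤ e.1 ∧ e.1 ≤ klCTcap8 ∧ ∀ Q cc, 0 < e.2 Q cc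

/-- An Export7-capped package is Export8-capped (the (X).3 conjunct under «A25» is WEAKER than the frozen one). -/
theorem IsTransferPkg7.toPkg8 {e : ℝ × (EngConsts → ℝ → ℝ)} (h : IsTransferPkg7 e) : IsTransferPkg8 e := ⟨h.1, h.2.1.trans klCTcap7_le_klCTcap8, h.2.2⟩

/-- A capped package is a rev-3 package. -/
theorem IsTransferPkg8.toPkg4 {e : ℝ × (EngConsts → ℝ → ℝ)} (h : IsTransferPkg8 e) : IsTransferPkg4 e := ⟨h.1, h.2.2⟩

/-- The trivial package `(0, 1)` is capped-admissible. -/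
theorem isTransferPkg8_zero : IsTransferPkg8 (0, fun _ _ => 1) := ⟨le_rfl, klCTcap8_pos.le, fun _ _ => one_pos⟩

/-- **Today's (X).3 implies the «A25» one**: a witness of `∃ e, IsTransferPkg7 e ∧ PairTransferStep7 P R Q₀ G Gth e.1 e.2` is a witness with `IsTransferPkg8`. -/
theorem exists_isTransferPkg8_of_exists_isTransferPkg7 {P : SplitConsts} {R : RenConsts} {Q₀ : EngConsts} {G Gth : GeoConsts}
    (h : ∃ e : ℝ × (EngConsts → ℝ → ℝ), IsTransferPkg7 e ∧ PairTransferStep7 P R Q₀ G Gth e.1 e.2) :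
    ∃ e : ℝ × (EngConsts → ℝ → ℝ), IsTransferPkg8 e ∧ PairTransferStep7 P R Q₀ G Gth e.1 e.2 := by
  obtain ⟨e, he, hs⟩ := h
  exact ⟨e, he.toPkg8, hs⟩

section Deferred

variable (P : SplitConsts) (R : RenConsts) (Q₀ : EngConsts) (G Gth : GeoConsts)

/-- **The deferred `klTS`-capped transfer package at `(G, Gth)`**: SOME capped-admissible `(r, u)` with `PairTransferStep7 P R Q₀ G Gth r u`, if one exists, else `(0, 1)`. -/
def klTransferPkg8 : ℝ × (EngConsts → ℝ → ℝ) :=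
  open scoped Classical in
  if h : ∃ e : ℝ × (EngConsts → ℝ → ℝ), IsTransferPkg8 e ∧ PairTransferStep7 P R Q₀ G Gth e.1 e.2 then Classical.choose h else (0, fun _ _ => 1)

/-- **`klCT8 P R Q₀ G Gth`** — the deferred `klTS`-capped transfer constant (stub (c)'s `htr` reads it at `(Q₀, G, Gth) = (klEngQ7 P R, klEngGeo14, klEngGeoTh)`). -/
def klCT8 : ℝ := (klTransferPkg8 P R Q₀ G Gth).1

/-- **`klCTu8 P R Q₀ G Gth`** — the deferred coupling threshold (the producer's own `u`; the U-door's class-#5 `min` entry at `(klEngQ9c P R, cc)` is it or `klCTu8T`). -/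
def klCTu8 : EngConsts → ℝ → ℝ := (klTransferPkg8 P R Q₀ G Gth).2

/-- **`klCTu8T P R Q₀ G Gth Q cc := klCTu8 … Q cc ⊓ klTSCapU P`** — the BUNDLED class-#5 u-slot: the producer's threshold AND the cap's U-side booking in ONE entry. -/
def klCTu8T : EngConsts → ℝ → ℝ := fun Q cc => min (klCTu8 P R Q₀ G Gth Q cc) (klTSCapU P)

/-- The deferred package is capped-admissible (unconditionally). -/
theorem isTransferPkg8_klTransferPkg8 : IsTransferPkg8 (klTransferPkg8 P R Q₀ G Gth) := by
  classical
  unfold klTransferPkg8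
  split_ifs with h
  · exact (Classical.choose_spec h).1
  · exact isTransferPkg8_zero

/-- `0 ≤ klCT8 P R Q₀ G Gth`. -/
theorem klCT8_nonneg : 0 ≤ klCT8 P R Q₀ G Gth := (isTransferPkg8_klTransferPkg8 P R Q₀ G Gth).1

/-- **`klCT8 P R Q₀ G Gth ≤ klCTcap8`.** -/
theorem klCT8_le_klCTcap8 : klCT8 P R Q₀ G Gth ≤ klCTcap8 := (isTransferPkg8_klTransferPkg8 P R Q₀ G Gth).2.1

/-- **`klCT8 P R Q₀ G Gth ≤ 2²⁰·(1 + klTS)`** — the literal the G14 hosting lemmas (`…_of_cap`) and `…OutClassCapShares` read. -/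
theorem klCT8_le_cap : klCT8 P R Q₀ G Gth ≤ 2 ^ 20 * (1 + klTS) := by rw [← klCTcap8_eq]; exact klCT8_le_klCTcap8 P R Q₀ G Gth

/-- `0 < klCTu8 P R Q₀ G Gth Q cc`. -/
theorem klCTu8_pos (Q : EngConsts) (cc : ℝ) : 0 < klCTu8 P R Q₀ G Gth Q cc := (isTransferPkg8_klTransferPkg8 P R Q₀ G Gth).2.2 Q cc

/-- `klCTu8T … Q cc ≤ klCTu8 … Q cc`. -/
theorem klCTu8T_le_klCTu8 (Q : EngConsts) (cc : ℝ) : klCTu8T P R Q₀ G Gth Q cc ≤ klCTu8 P R Q₀ G Gth Q cc := min_le_left _ _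

/-- `klCTu8T … Q cc ≤ klTSCapU P`. -/
theorem klCTu8T_le_klTSCapU (Q : EngConsts) (cc : ℝ) : klCTu8T P R Q₀ G Gth Q cc ≤ klTSCapU P := min_le_right _ _

/-- `0 < klCTu8T P R Q₀ G Gth Q cc` (unconditionally). -/
theorem klCTu8T_pos (Q : EngConsts) (cc : ℝ) : 0 < klCTu8T P R Q₀ G Gth Q cc := lt_min (klCTu8_pos P R Q₀ G Gth Q cc) (klTSCapU_pos P)

variable {P R Q₀ G Gth}

/-- **The cap's U-side smallness from the bundled u-slot**: `0 < U ≤ klCTu8T … Q cc ⇒ 2²⁶·klTS·(P.Klam·|U|) ≤ 1`. -/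
theorem hTU_of_le_klCTu8T {Q : EngConsts} {cc U : ℝ} (hU : 0 < U) (hUle : U ≤ klCTu8T P R Q₀ G Gth Q cc) : 2 ^ 26 * klTS * (P.Klam * |U|) ≤ 1 :=
  hTU_of_le_klTSCapU hU (hUle.trans (klCTu8T_le_klTSCapU P R Q₀ G Gth Q cc))

/-- **The step holds for the deferred capped package as soon as it holds for some capped-admissible package** (how §C reads (X).3 under Export8). -/
theorem pairTransferStep7_klCT8_of_exists (h : ∃ e : ℝ × (EngConsts → ℝ → ℝ), IsTransferPkg8 e ∧ PairTransferStep7 P R Q₀ G Gth e.1 e.2) :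
    PairTransferStep7 P R Q₀ G Gth (klCT8 P R Q₀ G Gth) (klCTu8 P R Q₀ G Gth) := by
  classical
  have hpkg : klTransferPkg8 P R Q₀ G Gth = Classical.choose h := by
    unfold klTransferPkg8
    rw [dif_pos h]
  unfold klCT8 klCTu8
  rw [hpkg]
  exact (Classical.choose_spec h).2

/-- Packaging an explicit witness (`0 ≤ r ≤ klCTcap8`, `u > 0`). -/
theorem pairTransferStep7_klCT8_of {r : ℝ} {u : EngConsts → ℝ → ℝ} (hr : 0 ≤ r) (hrc : r ≤ klCTcap8) (hu : ∀ Q cc, 0 < u Q cc)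
    (hs : PairTransferStep7 P R Q₀ G Gth r u) : PairTransferStep7 P R Q₀ G Gth (klCT8 P R Q₀ G Gth) (klCTu8 P R Q₀ G Gth) :=
  pairTransferStep7_klCT8_of_exists ⟨(r, u), ⟨hr, hrc, hu⟩, hs⟩

/-- **The rev-15 (X).3 conjunct from an explicit `klTS`-capped witness** (the producer's packager reads `hrc : r ≤ klCTcap8`; nothing else of the chain reads the cap). -/
theorem exists_isTransferPkg8_of_step7 {r : ℝ} {u : EngConsts → ℝ → ℝ} (hr : 0 ≤ r) (hrc : r ≤ klCTcap8) (hu : ∀ Q cc, 0 < u Q cc)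
    (hs : PairTransferStep7 P R Q₀ G Gth r u) : ∃ e : ℝ × (EngConsts → ℝ → ℝ), IsTransferPkg8 e ∧ PairTransferStep7 P R Q₀ G Gth e.1 e.2 :=
  ⟨(r, u), ⟨hr, hrc, hu⟩, hs⟩

/-- … the same with the cap written as the literal `2²⁰·(1 + klTS)`. -/
theorem exists_isTransferPkg8_of_step7_lit {r : ℝ} {u : EngConsts → ℝ → ℝ} (hr : 0 ≤ r) (hrc : r ≤ 2 ^ 20 * (1 + klTS)) (hu : ∀ Q cc, 0 < u Q cc)
    (hs : PairTransferStep7 P R Q₀ G Gth r u) : ∃ e : ℝ × (EngConsts → ℝ → ℝ), IsTransferPkg8 e ∧ PairTransferStep7 P R Q₀ G Gth e.1 e.2 :=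
  exists_isTransferPkg8_of_step7 hr (by rwa [klCTcap8_eq]) hu hs

end Deferred

/-! ## §3 The unroll at the deferred capped package (the term §C's `htr` line calls) -/

section Unroll

variable {P : SplitConsts} {R : RenConsts} {Q₀ Q : EngConsts} {G Gth : GeoConsts} {cc μ U β : ℝ} {L M : ℕ} [NeZero L] [NeZero M]

/-- **CLASS #5 UNROLLED at the deferred `klTS`-capped package** (§C's `htr` line under Export8): from `∃ e, IsTransferPkg8 e ∧ PairTransferStep7 P R Q₀ G Gth e.1 e.2`,
under the binders of `pairTransferRelFamilyK5_klCT7_all_of_exists` VERBATIM with `U ≤ klCTu8 P R Q₀ G Gth Q cc`: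
`PairTransferRelFamilyK5 L M Gth P (klCT8 P R Q₀ G Gth) β U μ j` at every `j ≤ n`. -/
theorem pairTransferRelFamilyK5_klCT8_all_of_exists (hex : ∃ e : ℝ × (EngConsts → ℝ → ℝ), IsTransferPkg8 e ∧ PairTransferStep7 P R Q₀ G Gth e.1 e.2) (hG : G.WF)
    (hQ : Q₀.IsRaiseOf Q) (hcc0 : 0 < cc) (hcc : cc ≤ klEngC₃6 P R) (hμ : μ ∈ klWindowC) (h0 : FrameOK R U (nScales β) μ 0) (hU : 0 < U)
    (hU10 : U ≤ klEngU₀10 P R cc) (hUu : U ≤ klCTu8 P R Q₀ G Gth Q cc) (hβ : klBetaMin ≤ β) (hβc : β ≤ Real.exp (cc / U ^ 2)) (hL : klEngL₄ P R β U ≤ L)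
    (hM : klEngM₃ β U L ≤ M) (hR : R.WF2) {n : ℕ} (hn : n ≤ nScales β + 1) (hhist : HistP klPredsV17F2 L M G P Q R β U μ 0 n)
    (hlev : ∀ j ≤ n, LevelsUExportMixedAt L M (klCU2 P R Q₀) P β U μ j) : ∀ j ≤ n, PairTransferRelFamilyK5 L M Gth P (klCT8 P R Q₀ G Gth) β U μ j :=
  pairTransferRelFamilyK5_all_of_step7 (pairTransferStep7_klCT8_of_exists hex) hG hQ hcc0 hcc hμ h0 hU hU10 hUu hβ hβc hL hM hR hn hhist hlev

/-- **The same unroll with the u-row at the BUNDLED slot** `U ≤ klCTu8T P R Q₀ G Gth Q cc` (token #14 `⊓ klCTu8T …`). -/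
theorem pairTransferRelFamilyK5_klCT8_all_of_exists_T (hex : ∃ e : ℝ × (EngConsts → ℝ → ℝ), IsTransferPkg8 e ∧ PairTransferStep7 P R Q₀ G Gth e.1 e.2) (hG : G.WF)
    (hQ : Q₀.IsRaiseOf Q) (hcc0 : 0 < cc) (hcc : cc ≤ klEngC₃6 P R) (hμ : μ ∈ klWindowC) (h0 : FrameOK R U (nScales β) μ 0) (hU : 0 < U)
    (hU10 : U ≤ klEngU₀10 P R cc) (hUu : U ≤ klCTu8T P R Q₀ G Gth Q cc) (hβ : klBetaMin ≤ β) (hβc : β ≤ Real.exp (cc / U ^ 2)) (hL : klEngL₄ P R β U ≤ L)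
    (hM : klEngM₃ β U L ≤ M) (hR : R.WF2) {n : ℕ} (hn : n ≤ nScales β + 1) (hhist : HistP klPredsV17F2 L M G P Q R β U μ 0 n)
    (hlev : ∀ j ≤ n, LevelsUExportMixedAt L M (klCU2 P R Q₀) P β U μ j) : ∀ j ≤ n, PairTransferRelFamilyK5 L M Gth P (klCT8 P R Q₀ G Gth) β U μ j :=
  pairTransferRelFamilyK5_klCT8_all_of_exists hex hG hQ hcc0 hcc hμ h0 hU hU10 (hUu.trans (klCTu8T_le_klCTu8 P R Q₀ G Gth Q cc)) hβ hβc hL hM hR hn hhist hlev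

end Unroll

/-! ## §4 The (c) closer's (E2-F2) input BY NAME at `klCT8`: the direct door (shares: `…Export8Shares`) -/

section Direct

variable {L M : ℕ} [NeZero L] [NeZero M]

/-- **(E2-F2) `PairLadderStepAtV17F2 L M G P Q β U μ n` (`1 ≤ n ≤ n_β + 1`) DIRECTLY from the `htr` family at `n − 1`** — `pairLadderStepAtV17F2_of_relFamilyK5_klCT7`'s twin at
`r := klCT8 P R Q₀ G′ Gth` (`pairLadderStepAtV17F2_of_relFamilyK5` + `klCT8_nonneg`; bar `Tb := transferBarRelIdx L Gth P (klCT8 …) β U (n−1) (n−1)`, content slot by slot: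
`transferBarRelIdx_klCT8_le_slots_klEngGeo14` / `relBar_klCT8_le_bars_klEngGeo14`). -/
theorem pairLadderStepAtV17F2_of_relFamilyK5_klCT8 {G G' Gth : GeoConsts} (hCF : 0 ≤ Gth.CF) {P : SplitConsts} (hKl : 0 ≤ P.Klam) {Q Q₀ : EngConsts} {R Rn : RenConsts}
    {N : ℕ} {β U μ : ℝ} {n : ℕ} {m : ℝ} (hn : 1 ≤ n) (hnS : n ≤ nScales β + 1) (hm : 0 ≤ m)
    (hK : FrameOK Rn U N μ (klFlowFrameU L M β U μ (n - 1))) (hβ : klBetaMin ≤ β) (hβL : β ≤ L) (hG : (2 : ℝ) ^ 18 ≤ G.bhi)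
    (hfam : PairTransferRelFamilyK5 L M Gth P (klCT8 P R Q₀ G' Gth) β U μ (n - 1))
    (hC₀ : ∀ Qm s t, ‖klPairArrayF L M β U μ (n - 1) Qm s t‖ ≤ m)
    (hsm₀ : m * (G.bhi / 4) ≤ 1 / 3)
    (htower : ∀ Qm : TorusSite 2 L, IsPairClassAt L Qm n →
      ∃ (X Nm : Matrix (TorusSite 2 L) (TorusSite 2 L) ℂ) (w₁ : TorusSite 2 L → ℝ) (Ea E₁ : TorusSite 2 L → TorusSite 2 L → ℝ) (r' e₁ : ℝ),
        0 ≤ r' ∧ 0 ≤ e₁ ∧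
        (∀ x y, ¬(x ∈ klBall L μ 0 ∧ y ∈ klBall L μ 0) → X x y = 0) ∧
        (∀ k ∈ klBall L μ 0, ∀ k' ∈ klBall L μ 0,
          X k k' = klCovSmearedPairAmplitude L M β U μ (klFlowFrameU L M β U μ (n - 1)) (n - 1)
            (softCovOf L M β μ (klFlowFrameU L M β U μ (n - 1)) (softSymbolCompl L M β μ (klFlowFrameU L M β U μ (n - 1)) (n - 1) n)) Qm k k') ∧
        (∀ x y, 0 ≤ Ea x y) ∧
        (1 + Matrix.diagonal (fun p => (w₁ p : ℂ)) * X) * Nm = 1 ∧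
        (∀ k ∈ klBall L μ 0, ∀ k' ∈ klBall L μ 0, ‖klPairArrayF L M β U μ n Qm k k' - (X * Nm) k k'‖ ≤ Ea k k') ∧
        (∀ x y, transferBarRelIdx L Gth P (klCT8 P R Q₀ G' Gth) β U (n - 1) (n - 1) Qm x y ≤ r') ∧
        (∀ x y, Ea x y + (transferBarRelIdx L Gth P (klCT8 P R Q₀ G' Gth) β U (n - 1) (n - 1) Qm x y +
            3 / 2 * (3 / 2 * m) * ∑ t, transferBarRelIdx L Gth P (klCT8 P R Q₀ G' Gth) β U (n - 1) (n - 1) Qm x t * |w₁ t| +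
            3 / 2 * (3 / 2 * m + r') * ∑ a, |w₁ a| * transferBarRelIdx L Gth P (klCT8 P R Q₀ G' Gth) β U (n - 1) (n - 1) Qm a y +
            9 / 4 * (3 / 2 * m + r') * (3 / 2 * m) *
              ∑ a, ∑ t, |w₁ a| * transferBarRelIdx L Gth P (klCT8 P R Q₀ G' Gth) β U (n - 1) (n - 1) Qm a t * |w₁ t|) ≤ E₁ x y) ∧
        (∀ x y, E₁ x y ≤ e₁) ∧
        (3 / 2 * m + r') * ∑ a, |w₁ a| ≤ 1 / 3 ∧
        (∑ p, |w₁ p| ≤ 3 / 4 * G.bhi) ∧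
        (∑ p, (|w₁ p| - w₁ p) ≤ klEdge G n (klTorusNorm L Qm)) ∧
        (∀ k ∈ klBall L μ 0, ∀ k' ∈ klBall L μ 0,
          E₁ k k' ≤
            drivePBar G P U (n - 1) + eremBar G P Q U β L (n - 1) + thermalBar G P U β n +
              legDressBarQ2 G P Q U n (legSliceCountT L β μ (klFlowFrameU L M β U μ n) n ![k', Qm - k', Qm - k, k]) +
              (P.Klam * U) ^ 2 * (G.phGain n (klTorusNorm L (k - k')) + G.phGain n (klTorusNorm L (k + k' - Qm))) +
              frameShiftBar P Q U n)) :
    PairLadderStepAtV17F2 L M G P Q β U μ n :=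
  pairLadderStepAtV17F2_of_relFamilyK5 L M hCF hKl (klCT8_nonneg P R Q₀ G' Gth) hn hnS hm hK hβ hβL hG hfam hC₀ hsm₀ htower

end Direct



end Summit.HubbardSuperconductivity.HubbardSuperconductivity.Theorems.EngineV8

end
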